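import Mathlib.Geometry.Manifold.SmoothEmbedding
import Mathlib.Geometry.Manifold.ContMDiff.Atlas
import Mathlib.Geometry.Manifold.ContMDiff.NormedSpace
import Mathlib.Geometry.Manifold.Metrizable
import Literature.Topology.FourManifolds.CircleSurgery
import HarnessLib

/-!
# The open gluing (pushout) of two smooth manifolds along a partial diffeomorphism

Construction, missing from Mathlib, of the smooth manifold `A ∪_ψ B` obtained by gluing two
boundaryless smooth manifolds `A`, `B` (models `I_A`, `I_B` on normed spaces `E_A ≃ E_P ≃ E_B`)
along a diffeomorphism `ψ : U ≅ V` between open subsets `U ⊆ A`, `V ⊆ B`, given as an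
`OpenPartialHomeomorph A B` which is `C^∞` in both directions (Kosinski, *Differential Manifolds*
(1993), VI.1 and I.(5.1); Kervaire–Milnor, *Groups of homotopy spheres I*, Ann. of Math. 77
(1963), §2; Hirsch, *Differential Topology* (1976), Ch. 1 §1 Ex.). This realises the relational
predicates `Literature.Topology.FourManifolds.IsOpenGluing` / `Literature.Topology.FourManifolds.IsOpenGluingWith` of the `FourManM`/`FourManL` preludes.

## Main definitions and results

* `Literature.SmoothGlueData I_A I_B A B E_P`: the datum `(ψ, e_A, e_B)`; `d.Glued`: the pushout
  `(A ⊕ B) / (a ∼ ψ a)` with the quotient topology; `d.inl : A → d.Glued`, `d.inr : B → d.Glued`.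
* `d.isOpenEmbedding_inl/inr`, `d.inl_eq_inr_iff : d.inl a = d.inr b ↔ a ∈ ψ.source ∧ ψ a = b`,
  `d.range_inl_union_range_inr`.
* `d.t2Space_of_isClosed_graph`: `d.Glued` is Hausdorff if the graph of `ψ` is closed in `A × B`.
* `d.compactSpace_of_subset`: `d.Glued` is compact if compact sets `K_A`, `K_B` cover it.
* `instChartedSpace : ChartedSpace E_P d.Glued` (charts: maximal-atlas charts of the pieces,
  lifted along `inl`/`inr` and composed with `I_A`, `e_A` resp. `I_B`, `e_B`) and
  `instIsManifold : IsManifold 𝓘(ℝ, E_P) ∞ d.Glued`.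
* `d.isSmoothEmbedding_inl/inr`, and more generally `d.isImmersionAtOfComplement_inl_comp`:
  `inl ∘ g` is an immersion where `g` is.
* `d.isOpenGluingWith`: `IsOpenGluingWith I_A I_B 𝓘(ℝ, E_P) R d.inl d.inr` for every relation `R`
  equivalent to the graph of `ψ`.

## Design

The atlas of `d.Glued` consists of *all* charts `(e.transHomeomorph T_A).lift_openEmbedding inl`
with `e` in the **maximal** `C^∞` atlas of `A` (and likewise for `B`), where
`T_A = I_A.toHomeomorph.trans e_A.toHomeomorph : H_A ≃ₜ E_P`; compatibility of two such charts is
`StructureGroupoid.compatible_of_mem_maximalAtlas` on one piece and the smoothness of `ψ` across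
pieces. Taking the maximal atlases makes "`inl ∘ g` is an immersion if `g` is" immediate, which is
how maps into a glued manifold (sections, tubular neighbourhoods) are shown to be smooth
embeddings downstream (Cappell–Shaneson construction).
-/

open scoped Manifold ContDiff Topology
open Set Function Topology OpenPartialHomeomorph

noncomputable section

namespace Literature.Topology.FourManifolds

universe uA uB

variable {E_A H_A E_B H_B : Type*}
  [NormedAddCommGroup E_A] [NormedSpace ℝ E_A] [TopologicalSpace H_A]
  [NormedAddCommGroup E_B] [NormedSpace ℝ E_B] [TopologicalSpace H_B]

/-- **Gluing datum** for two manifolds `A`, `B` (models `I_A`, `I_B`) into a manifold modelled on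
the normed space `E_P`: an open partial homeomorphism `glue : A ⇀ B` (the identification
`a ∼ glue a` for `a ∈ glue.source`) which is `C^∞` in both directions, and continuous linear
identifications of the model vector spaces with `E_P` (Kosinski, *Differential Manifolds*, VI.1;
Kervaire–Milnor 1963, §2). [folklore] -/
structure SmoothGlueData (I_A : ModelWithCorners ℝ E_A H_A) (I_B : ModelWithCorners ℝ E_B H_B)
    (A : Type uA) [TopologicalSpace A] [ChartedSpace H_A A]
    (B : Type uB) [TopologicalSpace B] [ChartedSpace H_B B]
    (E_P : Type*) [NormedAddCommGroup E_P] [NormedSpace ℝ E_P] where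
  /-- The gluing partial diffeomorphism `U ≅ V`, `U ⊆ A`, `V ⊆ B` open. -/
  glue : OpenPartialHomeomorph A B
  /-- The gluing map is smooth on its source. -/
  contMDiffOn_glue : ContMDiffOn I_A I_B ∞ glue glue.source
  /-- The inverse gluing map is smooth on its source. -/
  contMDiffOn_glue_symm : ContMDiffOn I_B I_A ∞ glue.symm glue.target
  /-- Identification of the model vector space of `A` with `E_P`. -/
  linA : E_A ≃L[ℝ] E_P
  /-- Identification of the model vector space of `B` with `E_P`. -/
  linB : E_B ≃L[ℝ] E_P

namespace SmoothGlueData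

variable {I_A : ModelWithCorners ℝ E_A H_A} {I_B : ModelWithCorners ℝ E_B H_B}
  {A : Type uA} [TopologicalSpace A] [ChartedSpace H_A A]
  {B : Type uB} [TopologicalSpace B] [ChartedSpace H_B B]
  {E_P : Type*} [NormedAddCommGroup E_P] [NormedSpace ℝ E_P]
  (d : SmoothGlueData I_A I_B A B E_P)

/-! ### The pushout as a topological space -/

/-- The gluing relation on `A ⊕ B` generated by `inl a ∼ inr (glue a)`, `a ∈ glue.source`; it is
already an equivalence relation because `glue` is injective on its source. [folklore] -/
def Rel : A ⊕ B → A ⊕ B → Prop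
  | Sum.inl a, Sum.inl a' => a = a'
  | Sum.inr b, Sum.inr b' => b = b'
  | Sum.inl a, Sum.inr b => a ∈ d.glue.source ∧ d.glue a = b
  | Sum.inr b, Sum.inl a => a ∈ d.glue.source ∧ d.glue a = b

/-- The gluing relation is an equivalence relation. [folklore] -/
theorem rel_equivalence : Equivalence d.Rel where
  refl x := by cases x <;> simp [Rel]
  symm {x y} h := by
    cases x <;> cases y <;> simp only [Rel] at h ⊢
    · exact h.symm
    · exact h
    · exact h
    · exact h.symm
  trans {x y z} h h' := by
    cases x <;> cases y <;> cases z <;> simp only [Rel] at h h' ⊢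
    · exact h.trans h'
    · rw [h]; exact h'
    · exact d.glue.injOn h.1 h'.1 (h.2.trans h'.2.symm)
    · rw [← h']; exact h
    · rw [h'] at h; exact h
    · exact h.2.symm.trans h'.2
    · rw [← h] at h'; exact h'
    · exact h.trans h'

/-- The gluing setoid on `A ⊕ B`. [folklore] -/
def glueSetoid : Setoid (A ⊕ B) := ⟨d.Rel, d.rel_equivalence⟩

/-- **The glued space** `A ∪_glue B = (A ⊕ B) / (a ∼ glue a)` (Kosinski, *Differential
Manifolds*, VI.1). [folklore] -/
def Glued : Type (max uA uB) := Quotient d.glueSetoid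

/-- The quotient topology on the glued space. [folklore] -/
instance instTopologicalSpace : TopologicalSpace d.Glued :=
  inferInstanceAs (TopologicalSpace (Quotient d.glueSetoid))

/-- The quotient map `A ⊕ B → A ∪_glue B`. [folklore] -/
def proj (x : A ⊕ B) : d.Glued := Quotient.mk d.glueSetoid x

/-- The first piece `A → A ∪_glue B`. [folklore] -/
def inl (a : A) : d.Glued := d.proj (Sum.inl a)

/-- The second piece `B → A ∪_glue B`. [folklore] -/
def inr (b : B) : d.Glued := d.proj (Sum.inr b)

/-- Two points of `A ⊕ B` have the same image iff they are related. [folklore] -/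
theorem proj_eq_proj_iff {x y : A ⊕ B} : d.proj x = d.proj y ↔ d.Rel x y :=
  Quotient.eq (r := d.glueSetoid)

/-- `inl` is injective. [folklore] -/
theorem inl_injective : Injective d.inl := fun _ _ h ↦ d.proj_eq_proj_iff.1 h

/-- `inr` is injective. [folklore] -/
theorem inr_injective : Injective d.inr := fun _ _ h ↦ d.proj_eq_proj_iff.1 h

/-- **The gluing identification**: `inl a = inr b` iff `a ∈ glue.source` and `glue a = b`. [folklore] -/
theorem inl_eq_inr_iff {a : A} {b : B} : d.inl a = d.inr b ↔ a ∈ d.glue.source ∧ d.glue a = b :=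
  d.proj_eq_proj_iff

/-- `inl a = inr (glue a)` for `a` in the gluing region. [folklore] -/
theorem inr_glue {a : A} (ha : a ∈ d.glue.source) : d.inr (d.glue a) = d.inl a :=
  (d.inl_eq_inr_iff.2 ⟨ha, rfl⟩).symm

/-- `inl (glue.symm b) = inr b` for `b` in the gluing region. [folklore] -/
theorem inl_glue_symm {b : B} (hb : b ∈ d.glue.target) : d.inl (d.glue.symm b) = d.inr b :=
  d.inl_eq_inr_iff.2 ⟨d.glue.map_target hb, d.glue.right_inv hb⟩

/-- The quotient map is surjective. [folklore] -/
theorem proj_surjective : Surjective d.proj := Quotient.mk_surjective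

/-- The quotient map is a quotient map. [folklore] -/
theorem isQuotientMap_proj : IsQuotientMap d.proj := isQuotientMap_quotient_mk'

/-- The quotient map is continuous. [folklore] -/
theorem continuous_proj : Continuous d.proj := continuous_quotient_mk'

/-- `inl` is continuous. [folklore] -/
theorem continuous_inl : Continuous d.inl := d.continuous_proj.comp _root_.continuous_inl

/-- `inr` is continuous. [folklore] -/
theorem continuous_inr : Continuous d.inr := d.continuous_proj.comp _root_.continuous_inr

/-- **The two pieces cover** the glued space. [folklore] -/
theorem range_inl_union_range_inr : range d.inl ∪ range d.inr = univ := by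
  refine eq_univ_of_forall fun p ↦ ?_
  obtain ⟨x | x, rfl⟩ := d.proj_surjective p
  · exact Or.inl ⟨x, rfl⟩
  · exact Or.inr ⟨x, rfl⟩

/-- Every point of the glued space comes from `A` or from `B`. [folklore] -/
theorem exists_inl_or_inr (p : d.Glued) : (∃ a, d.inl a = p) ∨ ∃ b, d.inr b = p := by
  have := d.range_inl_union_range_inr ▸ mem_univ p
  exact this

/-- Preimage under `Sum.inr` of the saturation of `Sum.inl '' s`: it is `glue '' (s ∩ source)`. [folklore] -/
theorem preimage_inr_image_inl (s : Set A) :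
    d.inr ⁻¹' (d.inl '' s) = d.glue '' (s ∩ d.glue.source) := by
  ext b
  simp only [mem_preimage, mem_image, mem_inter_iff]
  constructor
  · rintro ⟨a, ha, h⟩
    rw [inl_eq_inr_iff] at h
    exact ⟨a, ⟨ha, h.1⟩, h.2⟩
  · rintro ⟨a, ⟨ha, ha'⟩, rfl⟩
    exact ⟨a, ha, (d.inr_glue ha').symm⟩

/-- Preimage under `Sum.inl` of the saturation of `Sum.inr '' s`: it is `glue.symm '' (s ∩ target)`. [folklore] -/
theorem preimage_inl_image_inr (s : Set B) :
    d.inl ⁻¹' (d.inr '' s) = d.glue.symm '' (s ∩ d.glue.target) := by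
  ext a
  simp only [mem_preimage, mem_image, mem_inter_iff]
  constructor
  · rintro ⟨b, hb, h⟩
    rw [eq_comm, inl_eq_inr_iff] at h
    exact ⟨b, ⟨hb, h.2 ▸ d.glue.map_source h.1⟩, h.2 ▸ d.glue.left_inv h.1⟩
  · rintro ⟨b, ⟨hb, hb'⟩, rfl⟩
    exact ⟨b, hb, (d.inl_glue_symm hb').symm⟩

/-- `inl` is an open map: the saturation of an open `s ⊆ A` meets `A` in `s` and `B` in the open
set `glue '' (s ∩ source)`. [folklore] -/
theorem isOpenMap_inl : IsOpenMap d.inl := by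
  intro s hs
  rw [← d.isQuotientMap_proj.isOpen_preimage, isOpen_sum_iff]
  constructor
  · have : Sum.inl ⁻¹' (d.proj ⁻¹' (d.inl '' s)) = s := by
      ext a; exact d.inl_injective.mem_set_image
    rw [this]; exact hs
  · change IsOpen (d.inr ⁻¹' (d.inl '' s))
    rw [d.preimage_inr_image_inl]
    exact d.glue.isOpen_image_of_subset_source (hs.inter d.glue.open_source) inter_subset_right

/-- `inr` is an open map. [folklore] -/
theorem isOpenMap_inr : IsOpenMap d.inr := by
  intro s hs
  rw [← d.isQuotientMap_proj.isOpen_preimage, isOpen_sum_iff]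
  constructor
  · change IsOpen (d.inl ⁻¹' (d.inr '' s))
    rw [d.preimage_inl_image_inr]
    exact d.glue.symm.isOpen_image_of_subset_source (hs.inter d.glue.open_target)
      inter_subset_right
  · have : Sum.inr ⁻¹' (d.proj ⁻¹' (d.inr '' s)) = s := by
      ext b; exact d.inr_injective.mem_set_image
    rw [this]; exact hs

/-- **`inl` is an open embedding.** [folklore] -/
theorem isOpenEmbedding_inl : IsOpenEmbedding d.inl :=
  .of_continuous_injective_isOpenMap d.continuous_inl d.inl_injective d.isOpenMap_inl

/-- **`inr` is an open embedding.** [folklore] -/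
theorem isOpenEmbedding_inr : IsOpenEmbedding d.inr :=
  .of_continuous_injective_isOpenMap d.continuous_inr d.inr_injective d.isOpenMap_inr

/-- The range of `inl` is open. [folklore] -/
theorem isOpen_range_inl : IsOpen (range d.inl) := d.isOpenEmbedding_inl.isOpen_range

/-- The range of `inr` is open. [folklore] -/
theorem isOpen_range_inr : IsOpen (range d.inr) := d.isOpenEmbedding_inr.isOpen_range

/-- A point `inl a` lies in the second piece iff `a` is in the gluing region. [folklore] -/
theorem inl_mem_range_inr_iff {a : A} : d.inl a ∈ range d.inr ↔ a ∈ d.glue.source :=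
  ⟨fun ⟨_, h⟩ ↦ (d.inl_eq_inr_iff.1 h.symm).1, fun h ↦ ⟨_, d.inr_glue h⟩⟩

/-- A point `inr b` lies in the first piece iff `b` is in the gluing region. [folklore] -/
theorem inr_mem_range_inl_iff {b : B} : d.inr b ∈ range d.inl ↔ b ∈ d.glue.target :=
  ⟨fun ⟨_, h⟩ ↦ by obtain ⟨h1, rfl⟩ := d.inl_eq_inr_iff.1 h; exact d.glue.map_source h1,
    fun h ↦ ⟨_, d.inl_glue_symm h⟩⟩

/-! ### Separation and compactness -/

/-- **Hausdorffness of the pushout.** If `A` and `B` are Hausdorff and the graph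
`{(a, glue a) | a ∈ source}` of the gluing map is closed in `A × B`, the glued space is Hausdorff
(Kosinski, *Differential Manifolds*, VI.1; this is the usual criterion, e.g. Bourbaki, *General
Topology*, I §8.6). [folklore] -/
theorem t2Space_of_isClosed_graph [T2Space A] [T2Space B]
    (h : IsClosed {p : A × B | p.1 ∈ d.glue.source ∧ d.glue p.1 = p.2}) : T2Space d.Glued := by
  -- separation of `inl a` from `inr b` when they differ
  have key : ∀ (a : A) (b : B), d.inl a ≠ d.inr b → ∃ u v : Set d.Glued, IsOpen u ∧ IsOpen v ∧
      d.inl a ∈ u ∧ d.inr b ∈ v ∧ Disjoint u v := by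
    intro a b hab
    have hmem : (a, b) ∉ {p : A × B | p.1 ∈ d.glue.source ∧ d.glue p.1 = p.2} := fun hp ↦
      hab (d.inl_eq_inr_iff.2 hp)
    obtain ⟨U, V, hU, hV, haU, hbV, hUV⟩ := isOpen_prod_iff.1 h.isOpen_compl a b hmem
    refine ⟨d.inl '' U, d.inr '' V, d.isOpenMap_inl U hU, d.isOpenMap_inr V hV,
      mem_image_of_mem _ haU, mem_image_of_mem _ hbV, ?_⟩
    rw [Set.disjoint_left]
    rintro _ ⟨a', ha', rfl⟩ ⟨b', hb', hb⟩
    exact hUV (mk_mem_prod ha' hb') (d.inl_eq_inr_iff.1 hb.symm)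
  rw [t2Space_iff]
  intro p q hpq
  obtain (⟨a, rfl⟩ | ⟨b, rfl⟩) := d.exists_inl_or_inr p <;>
    obtain (⟨a', rfl⟩ | ⟨b', rfl⟩) := d.exists_inl_or_inr q
  · obtain ⟨U, V, hU, hV, haU, hbV, hUV⟩ := t2_separation fun h ↦ hpq (congrArg d.inl h)
    refine ⟨d.inl '' U, d.inl '' V, d.isOpenMap_inl U hU, d.isOpenMap_inl V hV,
      mem_image_of_mem _ haU, mem_image_of_mem _ hbV, ?_⟩
    exact (Set.disjoint_image_iff d.inl_injective).2 hUV
  · exact key a b' hpq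
  · obtain ⟨u, v, hu, hv, hau, hbv, huv⟩ := key a' b (Ne.symm hpq)
    exact ⟨v, u, hv, hu, hbv, hau, huv.symm⟩
  · obtain ⟨U, V, hU, hV, haU, hbV, hUV⟩ := t2_separation fun h ↦ hpq (congrArg d.inr h)
    refine ⟨d.inr '' U, d.inr '' V, d.isOpenMap_inr U hU, d.isOpenMap_inr V hV,
      mem_image_of_mem _ haU, mem_image_of_mem _ hbV, ?_⟩
    exact (Set.disjoint_image_iff d.inr_injective).2 hUV

/-- **Compactness of the pushout** from compact pieces of the pieces: if compact sets `K_A ⊆ A`,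
`K_B ⊆ B` have images covering the glued space, it is compact. [folklore] -/
theorem compactSpace_of_subset {KA : Set A} {KB : Set B} (hKA : IsCompact KA) (hKB : IsCompact KB)
    (hcover : ∀ p, p ∈ d.inl '' KA ∪ d.inr '' KB) : CompactSpace d.Glued := by
  refine ⟨?_⟩
  have : (univ : Set d.Glued) = d.inl '' KA ∪ d.inr '' KB := (eq_univ_of_forall hcover).symm
  rw [this]
  exact (hKA.image d.continuous_inl).union (hKB.image d.continuous_inr)

/-- A convenient form of the compactness criterion: every point of `A` outside `K_A` is glued to a
point of `K_B`, and every point of `B` outside `K_B` is glued to a point of `K_A`. [folklore] -/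
theorem compactSpace_of_forall_not_mem {KA : Set A} {KB : Set B} (hKA : IsCompact KA)
    (hKB : IsCompact KB) (hA : ∀ a ∉ KA, a ∈ d.glue.source ∧ d.glue a ∈ KB)
    (hB : ∀ b ∉ KB, b ∈ d.glue.target ∧ d.glue.symm b ∈ KA) : CompactSpace d.Glued := by
  refine d.compactSpace_of_subset hKA hKB fun p ↦ ?_
  obtain (⟨a, rfl⟩ | ⟨b, rfl⟩) := d.exists_inl_or_inr p
  · by_cases ha : a ∈ KA
    · exact Or.inl (mem_image_of_mem _ ha)
    · obtain ⟨h1, h2⟩ := hA a ha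
      exact Or.inr ⟨_, h2, d.inr_glue h1⟩
  · by_cases hb : b ∈ KB
    · exact Or.inr (mem_image_of_mem _ hb)
    · obtain ⟨h1, h2⟩ := hB b hb
      exact Or.inl ⟨_, h2, d.inl_glue_symm h1⟩


end SmoothGlueData

/-! ### Compatibility of lifted charts (the one computation behind `IsManifold` of a gluing) -/

section LiftCompat

variable {E_P : Type*} [NormedAddCommGroup E_P] [NormedSpace ℝ E_P]
  {P : Type*} [TopologicalSpace P]
  {E H M : Type*} [NormedAddCommGroup E] [NormedSpace ℝ E] [TopologicalSpace H]
  {I : ModelWithCorners ℝ E H} [TopologicalSpace M] [ChartedSpace H M]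
  {E' H' M' : Type*} [NormedAddCommGroup E'] [NormedSpace ℝ E'] [TopologicalSpace H']
  {I' : ModelWithCorners ℝ E' H'} [TopologicalSpace M'] [ChartedSpace H' M']

/-- **Change of lifted charts.** Let `i : M → P`, `i' : M' → P` be open embeddings of two charted
spaces into a space `P` whose overlap is governed by a `C^∞` partial map `θ : M ⇀ M'`
(`i m = i' m' ↔ m ∈ θ.source ∧ θ m = m'`), and let `T : H ≃ₜ E_P`, `T' : H' ≃ₜ E_P` be `C^∞`
identifications of the model spaces with a common normed space (with `C^∞` inverses). Then for
charts `f`, `f'` in the maximal `C^∞` atlases of `M`, `M'`, the change of charts between the lifted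
charts `(f.transHomeomorph T).lift i` and `(f'.transHomeomorph T').lift i'` of `P` is `C^∞`: on its
source it is `T' ∘ f' ∘ θ ∘ f.symm ∘ T.symm` (Kosinski, *Differential Manifolds*, VI.1: the pushout
of smooth manifolds along a diffeomorphism of open subsets is smooth). [folklore] -/
theorem contDiffOn_lift_symm_trans_lift [Nonempty E_P] (T : H ≃ₜ E_P)
    (hT' : ContMDiff 𝓘(ℝ, E_P) I ∞ T.symm) (T' : H' ≃ₜ E_P) (hT'' : ContMDiff I' 𝓘(ℝ, E_P) ∞ T')
    {i : M → P} (hi : IsOpenEmbedding i) {i' : M' → P} (hi' : IsOpenEmbedding i')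
    (θ : OpenPartialHomeomorph M M') (hθ : ContMDiffOn I I' ∞ θ θ.source)
    (hcompat : ∀ m m', i m = i' m' ↔ m ∈ θ.source ∧ θ m = m')
    {f : OpenPartialHomeomorph M H} (hf : f ∈ IsManifold.maximalAtlas I ∞ M)
    {f' : OpenPartialHomeomorph M' H'} (hf' : f' ∈ IsManifold.maximalAtlas I' ∞ M') :
    ContDiffOn ℝ ∞
      (((f.transHomeomorph T).lift_openEmbedding hi).symm ≫ₕ
        (f'.transHomeomorph T').lift_openEmbedding hi')
      (((f.transHomeomorph T).lift_openEmbedding hi).symm ≫ₕ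
        (f'.transHomeomorph T').lift_openEmbedding hi').source := by
  set e := (f.transHomeomorph T).lift_openEmbedding hi
  set e' := (f'.transHomeomorph T').lift_openEmbedding hi'
  -- the honest formula and its domain
  set F : E_P → E_P := T' ∘ f' ∘ θ ∘ f.symm ∘ T.symm with hF
  set S : Set E_P := {u | T.symm u ∈ f.target ∧ f.symm (T.symm u) ∈ θ.source ∧
    θ (f.symm (T.symm u)) ∈ f'.source} with hS
  have hsub : (e.symm ≫ₕ e').source ⊆ S := by
    intro u hu
    simp only [trans_source, mem_inter_iff, mem_preimage, e, e', lift_openEmbedding_source,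
      symm_source, lift_openEmbedding_target, transHomeomorph_target, transHomeomorph_source,
      lift_openEmbedding_symm, comp_apply, transHomeomorph_symm_apply] at hu
    obtain ⟨hu1, m', hm', hmm'⟩ := hu
    obtain ⟨hm, rfl⟩ := (hcompat _ _).1 hmm'.symm
    exact ⟨hu1, hm, hm'⟩
  have heq : EqOn (e.symm ≫ₕ e') F (e.symm ≫ₕ e').source := by
    intro u hu
    simp only [trans_source, mem_inter_iff, mem_preimage, e, e', lift_openEmbedding_source,
      symm_source, lift_openEmbedding_target, transHomeomorph_target, transHomeomorph_source,
      lift_openEmbedding_symm, comp_apply, transHomeomorph_symm_apply] at hu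
    obtain ⟨-, m', -, hmm'⟩ := hu
    obtain ⟨hm, rfl⟩ := (hcompat _ _).1 hmm'.symm
    simp only [coe_trans, comp_apply, e, e', lift_openEmbedding_symm, transHomeomorph_symm_apply,
      hF]
    rw [hmm'.symm, lift_openEmbedding_apply, transHomeomorph_apply, comp_apply]
  refine (ContDiffOn.congr ?_ heq).mono le_rfl |>.mono le_rfl
  refine ContDiffOn.mono ?_ hsub
  rw [← contMDiffOn_iff_contDiffOn]
  have h1 : ContMDiffOn 𝓘(ℝ, E_P) I ∞ T.symm S := hT'.contMDiffOn
  have h2 : ContMDiffOn 𝓘(ℝ, E_P) I ∞ (f.symm ∘ T.symm) S :=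
    (contMDiffOn_symm_of_mem_maximalAtlas hf).comp h1 fun u hu ↦ hu.1
  have h3 : ContMDiffOn 𝓘(ℝ, E_P) I' ∞ (θ ∘ f.symm ∘ T.symm) S := hθ.comp h2 fun u hu ↦ hu.2.1
  have h4 : ContMDiffOn 𝓘(ℝ, E_P) I' ∞ (f' ∘ θ ∘ f.symm ∘ T.symm) S :=
    (contMDiffOn_of_mem_maximalAtlas hf').comp h3 fun u hu ↦ hu.2.2
  exact hT''.comp_contMDiffOn h4

end LiftCompat

namespace SmoothGlueData

variable {I_A : ModelWithCorners ℝ E_A H_A} {I_B : ModelWithCorners ℝ E_B H_B}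
  {A : Type uA} [TopologicalSpace A] [ChartedSpace H_A A]
  {B : Type uB} [TopologicalSpace B] [ChartedSpace H_B B]
  {E_P : Type*} [NormedAddCommGroup E_P] [NormedSpace ℝ E_P]
  (d : SmoothGlueData I_A I_B A B E_P)

/-! ### The smooth structure -/

section ModelA

variable [I_A.Boundaryless]

/-- The identification `H_A ≃ₜ E_P` of the model space of `A` with the model of the gluing:
`e_A ∘ I_A` (`I_A` is a homeomorphism onto `E_A` since it is boundaryless). [folklore] -/
def modelHomeoA : H_A ≃ₜ E_P := I_A.toHomeomorph.trans d.linA.toHomeomorph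

/-- `modelHomeoA h = e_A (I_A h)`. [folklore] -/
@[simp] theorem modelHomeoA_apply (h : H_A) : d.modelHomeoA h = d.linA (I_A h) := rfl

/-- `modelHomeoA.symm u = I_A.symm (e_A.symm u)`. [folklore] -/
@[simp] theorem modelHomeoA_symm_apply (u : E_P) :
    d.modelHomeoA.symm u = I_A.symm (d.linA.symm u) := rfl

/-- `modelHomeoA` is smooth. [folklore] -/
theorem contMDiff_modelHomeoA : ContMDiff I_A 𝓘(ℝ, E_P) ∞ d.modelHomeoA :=
  d.linA.toContinuousLinearMap.contMDiff.comp I_A.contMDiff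

/-- `modelHomeoA.symm` is smooth. [folklore] -/
theorem contMDiff_modelHomeoA_symm : ContMDiff 𝓘(ℝ, E_P) I_A ∞ d.modelHomeoA.symm := by
  have h : ContMDiff 𝓘(ℝ, E_A) I_A ∞ I_A.symm := fun x ↦
    (I_A.contMDiffOn_symm x (I_A.range_eq_univ.symm ▸ mem_univ x)).contMDiffAt
      (I_A.range_eq_univ.symm ▸ Filter.univ_mem)
  exact h.comp d.linA.symm.toContinuousLinearMap.contMDiff

/-- The chart of the glued space obtained from a chart `e` of `A`: on `inl '' e.source` it is
`e_A ∘ I_A ∘ e ∘ inl⁻¹` (Kosinski, VI.1). [folklore] -/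
def chartA (e : OpenPartialHomeomorph A H_A) : OpenPartialHomeomorph d.Glued E_P :=
  (e.transHomeomorph d.modelHomeoA).lift_openEmbedding d.isOpenEmbedding_inl

/-- The source of `chartA e` is `inl '' e.source`. [folklore] -/
@[simp] theorem chartA_source (e : OpenPartialHomeomorph A H_A) :
    (d.chartA e).source = d.inl '' e.source := rfl

/-- `chartA e (inl a) = e_A (I_A (e a))`. [folklore] -/
@[simp] theorem chartA_apply_inl (e : OpenPartialHomeomorph A H_A) (a : A) :
    d.chartA e (d.inl a) = d.linA (I_A (e a)) := by
  rw [chartA, lift_openEmbedding_apply]; rfl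

end ModelA

section ModelB

variable [I_B.Boundaryless]

/-- The identification `H_B ≃ₜ E_P` of the model space of `B` with the model of the gluing. [folklore] -/
def modelHomeoB : H_B ≃ₜ E_P := I_B.toHomeomorph.trans d.linB.toHomeomorph

/-- `modelHomeoB h = e_B (I_B h)`. [folklore] -/
@[simp] theorem modelHomeoB_apply (h : H_B) : d.modelHomeoB h = d.linB (I_B h) := rfl

/-- `modelHomeoB.symm u = I_B.symm (e_B.symm u)`. [folklore] -/
@[simp] theorem modelHomeoB_symm_apply (u : E_P) :
    d.modelHomeoB.symm u = I_B.symm (d.linB.symm u) := rfl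

/-- `modelHomeoB` is smooth. [folklore] -/
theorem contMDiff_modelHomeoB : ContMDiff I_B 𝓘(ℝ, E_P) ∞ d.modelHomeoB :=
  d.linB.toContinuousLinearMap.contMDiff.comp I_B.contMDiff

/-- `modelHomeoB.symm` is smooth. [folklore] -/
theorem contMDiff_modelHomeoB_symm : ContMDiff 𝓘(ℝ, E_P) I_B ∞ d.modelHomeoB.symm := by
  have h : ContMDiff 𝓘(ℝ, E_B) I_B ∞ I_B.symm := fun x ↦
    (I_B.contMDiffOn_symm x (I_B.range_eq_univ.symm ▸ mem_univ x)).contMDiffAt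
      (I_B.range_eq_univ.symm ▸ Filter.univ_mem)
  exact h.comp d.linB.symm.toContinuousLinearMap.contMDiff

/-- The chart of the glued space obtained from a chart `e` of `B`. [folklore] -/
def chartB (e : OpenPartialHomeomorph B H_B) : OpenPartialHomeomorph d.Glued E_P :=
  (e.transHomeomorph d.modelHomeoB).lift_openEmbedding d.isOpenEmbedding_inr

/-- The source of `chartB e` is `inr '' e.source`. [folklore] -/
@[simp] theorem chartB_source (e : OpenPartialHomeomorph B H_B) :
    (d.chartB e).source = d.inr '' e.source := rfl

/-- `chartB e (inr b) = e_B (I_B (e b))`. [folklore] -/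
@[simp] theorem chartB_apply_inr (e : OpenPartialHomeomorph B H_B) (b : B) :
    d.chartB e (d.inr b) = d.linB (I_B (e b)) := by
  rw [chartB, lift_openEmbedding_apply]; rfl

end ModelB

section Charts

variable [I_A.Boundaryless] [I_B.Boundaryless]
variable [IsManifold I_A ∞ A] [IsManifold I_B ∞ B]

/-- **The glued space as a charted space** on `E_P`: the atlas consists of the lifts of all
charts in the maximal `C^∞` atlases of the two pieces (Kosinski, *Differential Manifolds*, VI.1). [folklore] -/
instance instChartedSpace : ChartedSpace E_P d.Glued where
  atlas := d.chartA '' IsManifold.maximalAtlas I_A ∞ A ∪ d.chartB '' IsManifold.maximalAtlas I_B ∞ B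
  chartAt p := by
    classical
    exact if h : ∃ a, d.inl a = p then d.chartA (chartAt H_A (Classical.choose h))
      else d.chartB (chartAt H_B (Classical.choose ((d.exists_inl_or_inr p).resolve_left h)))
  mem_chart_source p := by
    by_cases h : ∃ a, d.inl a = p
    · simp only [h, ↓reduceDIte, chartA_source]
      exact ⟨_, mem_chart_source _ _, Classical.choose_spec h⟩
    · simp only [h, ↓reduceDIte, chartB_source]
      exact ⟨_, mem_chart_source _ _, Classical.choose_spec ((d.exists_inl_or_inr p).resolve_left h)⟩
  chart_mem_atlas p := by
    by_cases h : ∃ a, d.inl a = p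
    · simp only [h, ↓reduceDIte]
      exact Or.inl ⟨_, IsManifold.chart_mem_maximalAtlas _, rfl⟩
    · simp only [h, ↓reduceDIte]
      exact Or.inr ⟨_, IsManifold.chart_mem_maximalAtlas _, rfl⟩

/-- Description of the atlas of the glued space. [folklore] -/
theorem mem_atlas_iff {e : OpenPartialHomeomorph d.Glued E_P} :
    e ∈ atlas E_P d.Glued ↔ (∃ f ∈ IsManifold.maximalAtlas I_A ∞ A, d.chartA f = e) ∨
      ∃ f ∈ IsManifold.maximalAtlas I_B ∞ B, d.chartB f = e :=
  Iff.rfl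

/-- Lifts of maximal-atlas charts of `A` are charts of the glued space. [folklore] -/
theorem chartA_mem_atlas {f : OpenPartialHomeomorph A H_A} (hf : f ∈ IsManifold.maximalAtlas I_A ∞ A) :
    d.chartA f ∈ atlas E_P d.Glued :=
  Or.inl ⟨f, hf, rfl⟩

/-- Lifts of maximal-atlas charts of `B` are charts of the glued space. [folklore] -/
theorem chartB_mem_atlas {f : OpenPartialHomeomorph B H_B} (hf : f ∈ IsManifold.maximalAtlas I_B ∞ B) :
    d.chartB f ∈ atlas E_P d.Glued :=
  Or.inr ⟨f, hf, rfl⟩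

/-- **The glued space is a smooth manifold**: changes of charts within one piece are changes of
maximal-atlas charts, and across the pieces they are conjugates of the smooth gluing map
(Kosinski, *Differential Manifolds*, VI.1). [folklore] -/
instance instIsManifold : IsManifold 𝓘(ℝ, E_P) ∞ d.Glued := by
  refine isManifold_of_contDiffOn _ _ _ ?_
  rintro e e' (⟨f, hf, rfl⟩ | ⟨f, hf, rfl⟩) (⟨f', hf', rfl⟩ | ⟨f', hf', rfl⟩) <;>
    simp only [modelWithCornersSelf_coe, modelWithCornersSelf_coe_symm, CompTriple.comp_eq,
      range_id, inter_univ, preimage_id_eq, id_eq]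
  · exact contDiffOn_lift_symm_trans_lift d.modelHomeoA d.contMDiff_modelHomeoA_symm d.modelHomeoA
      d.contMDiff_modelHomeoA d.isOpenEmbedding_inl d.isOpenEmbedding_inl
      (OpenPartialHomeomorph.refl A) contMDiff_id.contMDiffOn
      (fun m m' ↦ by simp [d.inl_injective.eq_iff]) hf hf'
  · exact contDiffOn_lift_symm_trans_lift d.modelHomeoA d.contMDiff_modelHomeoA_symm d.modelHomeoB
      d.contMDiff_modelHomeoB d.isOpenEmbedding_inl d.isOpenEmbedding_inr d.glue d.contMDiffOn_glue
      (fun a b ↦ d.inl_eq_inr_iff) hf hf'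
  · exact contDiffOn_lift_symm_trans_lift d.modelHomeoB d.contMDiff_modelHomeoB_symm d.modelHomeoA
      d.contMDiff_modelHomeoA d.isOpenEmbedding_inr d.isOpenEmbedding_inl d.glue.symm
      d.contMDiffOn_glue_symm (fun b a ↦ by
        rw [eq_comm, d.inl_eq_inr_iff]
        constructor
        · rintro ⟨ha, rfl⟩; exact ⟨d.glue.map_source ha, d.glue.left_inv ha⟩
        · rintro ⟨hb, rfl⟩; exact ⟨d.glue.map_target hb, d.glue.right_inv hb⟩) hf hf'
  · exact contDiffOn_lift_symm_trans_lift d.modelHomeoB d.contMDiff_modelHomeoB_symm d.modelHomeoB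
      d.contMDiff_modelHomeoB d.isOpenEmbedding_inr d.isOpenEmbedding_inr
      (OpenPartialHomeomorph.refl B) contMDiff_id.contMDiffOn
      (fun m m' ↦ by simp [d.inr_injective.eq_iff]) hf hf'

end Charts

/-! ### Smooth embeddings into the glued space -/

section Immersion

variable [I_A.Boundaryless] [I_B.Boundaryless] [IsManifold I_A ∞ A] [IsManifold I_B ∞ B]
  {F : Type*} [NormedAddCommGroup F] [NormedSpace ℝ F]
  {E_Q H_Q : Type*} [NormedAddCommGroup E_Q] [NormedSpace ℝ E_Q] [TopologicalSpace H_Q]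
  {I_Q : ModelWithCorners ℝ E_Q H_Q} {Q : Type*} [TopologicalSpace Q] [ChartedSpace H_Q Q]

/-- **`inl ∘ g` is an immersion where `g` is.** If `g : Q → A` is a `C^∞` immersion at `q` with
complement `F` (charts `φ`, `χ` in which `g` reads `u ↦ L (u, 0)`), then `inl ∘ g : Q → A ∪ B` is
one too, with the lifted chart `chartA χ` of the glued space and `L` followed by `e_A`. This is
the reason the atlas of the glued space is built from the *maximal* atlases of the pieces. [folklore] -/
theorem isImmersionAtOfComplement_inl_comp {g : Q → A} {q : Q}
    (hg : Manifold.IsImmersionAtOfComplement F I_Q I_A ∞ g q) :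
    Manifold.IsImmersionAtOfComplement F I_Q 𝓘(ℝ, E_P) ∞ (d.inl ∘ g) q := by
  refine Manifold.IsImmersionAtOfComplement.mk_of_charts (hg.equiv.trans d.linA) hg.domChart
    (d.chartA hg.codChart) hg.mem_domChart_source ?_ hg.domChart_mem_maximalAtlas
    (IsManifold.subset_maximalAtlas (d.chartA_mem_atlas hg.codChart_mem_maximalAtlas)) ?_ ?_
  · exact ⟨_, hg.mem_codChart_source, rfl⟩
  · intro x hx
    exact ⟨_, hg.source_subset_preimage_source hx, rfl⟩
  · intro u hu
    have h := hg.writtenInCharts hu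
    simp only [comp_apply, extend_coe] at h
    simp only [comp_apply, extend_coe, modelWithCornersSelf_coe, id_eq, chartA_apply_inl,
      ContinuousLinearEquiv.trans_apply]
    rw [h]

/-- **`inr ∘ g` is an immersion where `g` is** (see `isImmersionAtOfComplement_inl_comp`). [folklore] -/
theorem isImmersionAtOfComplement_inr_comp {g : Q → B} {q : Q}
    (hg : Manifold.IsImmersionAtOfComplement F I_Q I_B ∞ g q) :
    Manifold.IsImmersionAtOfComplement F I_Q 𝓘(ℝ, E_P) ∞ (d.inr ∘ g) q := by
  refine Manifold.IsImmersionAtOfComplement.mk_of_charts (hg.equiv.trans d.linB) hg.domChart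
    (d.chartB hg.codChart) hg.mem_domChart_source ?_ hg.domChart_mem_maximalAtlas
    (IsManifold.subset_maximalAtlas (d.chartB_mem_atlas hg.codChart_mem_maximalAtlas)) ?_ ?_
  · exact ⟨_, hg.mem_codChart_source, rfl⟩
  · intro x hx
    exact ⟨_, hg.source_subset_preimage_source hx, rfl⟩
  · intro u hu
    have h := hg.writtenInCharts hu
    simp only [comp_apply, extend_coe] at h
    simp only [comp_apply, extend_coe, modelWithCornersSelf_coe, id_eq, chartB_apply_inr,
      ContinuousLinearEquiv.trans_apply]
    rw [h]

/-- A smooth embedding into `A` composed with `inl` is a smooth embedding into the glued space. [folklore] -/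
theorem isSmoothEmbedding_inl_comp {g : Q → A} (hg : Manifold.IsSmoothEmbedding I_Q I_A ∞ g) :
    Manifold.IsSmoothEmbedding I_Q 𝓘(ℝ, E_P) ∞ (d.inl ∘ g) := by
  obtain ⟨⟨F', _, _, hF⟩, hemb⟩ := hg
  exact ⟨Manifold.IsImmersionOfComplement.isImmersion fun q ↦
    d.isImmersionAtOfComplement_inl_comp (hF q), d.isOpenEmbedding_inl.isEmbedding.comp hemb⟩

/-- A smooth embedding into `B` composed with `inr` is a smooth embedding into the glued space. [folklore] -/
theorem isSmoothEmbedding_inr_comp {g : Q → B} (hg : Manifold.IsSmoothEmbedding I_Q I_B ∞ g) :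
    Manifold.IsSmoothEmbedding I_Q 𝓘(ℝ, E_P) ∞ (d.inr ∘ g) := by
  obtain ⟨⟨F', _, _, hF⟩, hemb⟩ := hg
  exact ⟨Manifold.IsImmersionOfComplement.isImmersion fun q ↦
    d.isImmersionAtOfComplement_inr_comp (hF q), d.isOpenEmbedding_inr.isEmbedding.comp hemb⟩

/-- **`inl : A → A ∪ B` is a smooth embedding** (Kosinski, VI.1). [folklore] -/
theorem isSmoothEmbedding_inl : Manifold.IsSmoothEmbedding I_A 𝓘(ℝ, E_P) ∞ d.inl :=
  d.isSmoothEmbedding_inl_comp Manifold.IsSmoothEmbedding.id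

/-- **`inr : B → A ∪ B` is a smooth embedding** (Kosinski, VI.1). [folklore] -/
theorem isSmoothEmbedding_inr : Manifold.IsSmoothEmbedding I_B 𝓘(ℝ, E_P) ∞ d.inr :=
  d.isSmoothEmbedding_inr_comp Manifold.IsSmoothEmbedding.id

/-- `inl` is smooth. [folklore] -/
theorem contMDiff_inl : ContMDiff I_A 𝓘(ℝ, E_P) ∞ d.inl := d.isSmoothEmbedding_inl.contMDiff

/-- `inr` is smooth. [folklore] -/
theorem contMDiff_inr : ContMDiff I_B 𝓘(ℝ, E_P) ∞ d.inr := d.isSmoothEmbedding_inr.contMDiff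

/-- **The glued space is an open gluing** in the sense of `Literature.Topology.FourManifolds.IsOpenGluingWith`, for any
relation `R` describing the graph of the gluing map (Kosinski, *Differential Manifolds*, VI.1;
Kervaire–Milnor 1963, §2). [folklore] -/
theorem isOpenGluingWith {R : A → B → Prop} (hR : ∀ a b, R a b ↔ a ∈ d.glue.source ∧ d.glue a = b) :
    IsOpenGluingWith I_A I_B 𝓘(ℝ, E_P) R d.inl d.inr :=
  ⟨d.isSmoothEmbedding_inl, d.isOpen_range_inl, d.isSmoothEmbedding_inr, d.isOpen_range_inr,
    d.range_inl_union_range_inr, fun a b ↦ d.inl_eq_inr_iff.trans (hR a b).symm⟩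

/-- The glued space is an open gluing (`Literature.Topology.FourManifolds.IsOpenGluing`) along any relation describing the graph
of the gluing map. [folklore] -/
theorem isOpenGluing {R : A → B → Prop} (hR : ∀ a b, R a b ↔ a ∈ d.glue.source ∧ d.glue a = b) :
    IsOpenGluing I_A I_B 𝓘(ℝ, E_P) (P := d.Glued) R :=
  (d.isOpenGluingWith hR).isOpenGluing

/-- A (σ-)compact glued space is second countable when the model space is (it is a charted
space over a second countable model, covered by countably many charts). [folklore] -/
theorem secondCountableTopology [SecondCountableTopology E_P] [SigmaCompactSpace d.Glued] :
    SecondCountableTopology d.Glued :=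
  ChartedSpace.secondCountable_of_sigmaCompact E_P d.Glued

end Immersion

end SmoothGlueData

end Literature.Topology.FourManifolds
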